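import Summits.AtomisticToContinuum.Crystallization.Theorems.OverbindingBudgetAffineFarCoreWindowsB

/-!
# «FarCoreWindows» (lens-4 g65, 31280 GEN-37 (F) far core: layer coordinates, registry-free layer sums, Fubini, windows, Z2-S assembly, rows (N♯)/(X4)/(SC), Gram certificate, pattern-map leaf, finite window data) — part 3 of 4 (sequel of `…OverbindingBudgetAffineFarCoreWindowsB`)

Split for the 400-line cap by the landing lane (hand-2 g30); the module docstring of part 1 (`…OverbindingBudgetAffineFarCoreWindowsA`) describes the whole node.  Same namespace; all FQNs unchanged.
0 sorry; standard axioms.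
-/


namespace Summit.AtomisticToContinuum.Crystallization.Theorems.OverbindingBudgetAffineFarSmoothSplit

open scoped BigOperators Classical
open Literature.MathematicalPhysics.StatisticalMechanics
open Literature.Geometry.DiscreteGeometry (fccTwoShellPattern hcpTwoShellPattern)

local notation "E3" => EuclideanSpace ℝ (Fin 3)

/-! ## §6b Row (X4): the quartic annulus by monotone cells -/

/-- Row (X4) data: the window's QUARTIC-MODEL FACT `f(E) ≥ e0 − g‖E‖ + (lam/2)‖E‖² − c3‖E‖³ − c4‖E‖⁴ − c5‖E‖⁵` on `‖E‖ ≤ r1` (moment enclosures to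
order 4 + analytic fifth-order remainder), the floor `phi`, the inner radius `r0` (where (X2) stops) and increasing breakpoints `ts` (last one `> r1`). -/
structure X4Row where
  /-- inner radius -/
  r0 : ℚ
  /-- model radius -/
  r1 : ℚ
  /-- value enclosure (lower) at the reference -/
  e0 : ℚ
  /-- gradient norm bound -/
  g : ℚ
  /-- least Hessian eigenvalue (lower) -/
  lam : ℚ
  /-- cubic, quartic, quintic remainder constants -/
  c3 : ℚ
  c4 : ℚ
  c5 : ℚ
  /-- the floor to certify -/
  phi : ℚ
  /-- breakpoints -/
  ts : List ℚ

/-- The monotone lower bound of the model on the cell `a ≤ ‖E‖ ≤ b`. -/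
def x4Lower (ρ : X4Row) (a b : ℚ) : ℚ :=
  ρ.e0 - ρ.g * b + ρ.lam / 2 * a ^ 2 - ρ.c3 * b ^ 3 - ρ.c4 * b ^ 4 - ρ.c5 * b ^ 5

/-- The cell chain: consecutive breakpoints are increasing, each cell's monotone lower bound clears the floor, and the chain ends beyond `r1`. -/
def x4Chain (ρ : X4Row) : ℚ → List ℚ → Bool
  | a, [] => decide (ρ.r1 < a)
  | a, b :: rest => (a ≤ b) && (ρ.phi ≤ x4Lower ρ a b) && x4Chain ρ b rest

/-- Row (X4) kernel. -/
def x4Check (ρ : X4Row) : Bool :=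
  (0 ≤ ρ.r0) && (0 ≤ ρ.g) && (0 ≤ ρ.lam) && (0 ≤ ρ.c3) && (0 ≤ ρ.c4) && (0 ≤ ρ.c5) && x4Chain ρ ρ.r0 ρ.ts

/-- Soundness of the cell chain (induction on the breakpoints). [this file] -/
theorem x4Chain_sound {V : Type*} [SeminormedAddCommGroup V] (f : V → ℝ) (ρ : X4Row) (hg : 0 ≤ ρ.g) (hlam : 0 ≤ ρ.lam) (hc3 : 0 ≤ ρ.c3)
    (hc4 : 0 ≤ ρ.c4) (hc5 : 0 ≤ ρ.c5)
    (hmodel : ∀ E : V, ‖E‖ ≤ (ρ.r1 : ℝ) → (ρ.e0 : ℝ) - (ρ.g : ℝ) * ‖E‖ + (ρ.lam : ℝ) / 2 * ‖E‖ ^ 2 - (ρ.c3 : ℝ) * ‖E‖ ^ 3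
      - (ρ.c4 : ℝ) * ‖E‖ ^ 4 - (ρ.c5 : ℝ) * ‖E‖ ^ 5 ≤ f E) :
    ∀ (ts : List ℚ) (a : ℚ), 0 ≤ a → x4Chain ρ a ts = true → ∀ E : V, (a : ℝ) ≤ ‖E‖ → ‖E‖ ≤ (ρ.r1 : ℝ) → (ρ.phi : ℝ) ≤ f E := by
  intro ts
  induction ts with
  | nil =>
    intro a _ h E hE0 hE1
    simp only [x4Chain, decide_eq_true_eq] at h
    have h' : (ρ.r1 : ℝ) < a := by exact_mod_cast h
    linarith
  | cons b rest ih =>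
    intro a ha h E hE0 hE1
    simp only [x4Chain, Bool.and_eq_true, decide_eq_true_eq] at h
    obtain ⟨⟨hab, hcell⟩, hrest⟩ := h
    by_cases hEb : ‖E‖ ≤ (b : ℝ)
    · have hcell' : (ρ.phi : ℝ) ≤ (ρ.e0 : ℝ) - ρ.g * b + ρ.lam / 2 * (a : ℝ) ^ 2 - ρ.c3 * (b : ℝ) ^ 3 - ρ.c4 * (b : ℝ) ^ 4 - ρ.c5 * (b : ℝ) ^ 5 := by
        have hc : ((ρ.phi : ℚ) : ℝ) ≤ ((x4Lower ρ a b : ℚ) : ℝ) := by exact_mod_cast hcell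
        unfold x4Lower at hc; push_cast at hc; exact hc
      have hm := hmodel E hE1
      have ha' : (0 : ℝ) ≤ a := by exact_mod_cast ha
      have t0 : 0 ≤ ‖E‖ := norm_nonneg _
      have hg' : (0 : ℝ) ≤ ρ.g := by exact_mod_cast hg
      have hl0 : (0 : ℝ) ≤ ρ.lam := by exact_mod_cast hlam
      have hl' : (0 : ℝ) ≤ ρ.lam / 2 := by linarith
      have h3' : (0 : ℝ) ≤ ρ.c3 := by exact_mod_cast hc3
      have h4' : (0 : ℝ) ≤ ρ.c4 := by exact_mod_cast hc4
      have h5' : (0 : ℝ) ≤ ρ.c5 := by exact_mod_cast hc5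
      have i1 : (ρ.g : ℝ) * ‖E‖ ≤ ρ.g * b := mul_le_mul_of_nonneg_left hEb hg'
      have i2 : (ρ.lam : ℝ) / 2 * (a : ℝ) ^ 2 ≤ ρ.lam / 2 * ‖E‖ ^ 2 := mul_le_mul_of_nonneg_left (pow_le_pow_left₀ ha' hE0 2) hl'
      have i3 : (ρ.c3 : ℝ) * ‖E‖ ^ 3 ≤ ρ.c3 * (b : ℝ) ^ 3 := mul_le_mul_of_nonneg_left (pow_le_pow_left₀ t0 hEb 3) h3'
      have i4 : (ρ.c4 : ℝ) * ‖E‖ ^ 4 ≤ ρ.c4 * (b : ℝ) ^ 4 := mul_le_mul_of_nonneg_left (pow_le_pow_left₀ t0 hEb 4) h4'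
      have i5 : (ρ.c5 : ℝ) * ‖E‖ ^ 5 ≤ ρ.c5 * (b : ℝ) ^ 5 := mul_le_mul_of_nonneg_left (pow_le_pow_left₀ t0 hEb 5) h5'
      linarith
    · exact ih b (le_trans ha hab) hrest E (le_of_lt (lt_of_not_ge hEb)) hE1

/-- ★ **Row (X4) soundness**: a passing row plus the window's quartic-model fact give `f ≥ phi` on the annulus `r0 ≤ ‖E‖ ≤ r1`. [this file] -/
theorem x4Check_sound {V : Type*} [SeminormedAddCommGroup V] (f : V → ℝ) (ρ : X4Row) (hρ : x4Check ρ = true)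
    (hmodel : ∀ E : V, ‖E‖ ≤ (ρ.r1 : ℝ) → (ρ.e0 : ℝ) - (ρ.g : ℝ) * ‖E‖ + (ρ.lam : ℝ) / 2 * ‖E‖ ^ 2 - (ρ.c3 : ℝ) * ‖E‖ ^ 3
      - (ρ.c4 : ℝ) * ‖E‖ ^ 4 - (ρ.c5 : ℝ) * ‖E‖ ^ 5 ≤ f E) :
    ∀ E : V, (ρ.r0 : ℝ) ≤ ‖E‖ → ‖E‖ ≤ (ρ.r1 : ℝ) → (ρ.phi : ℝ) ≤ f E := by
  simp only [x4Check, Bool.and_eq_true, decide_eq_true_eq] at hρ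
  obtain ⟨⟨⟨⟨⟨⟨h0, hg⟩, hlam⟩, hc3⟩, hc4⟩, hc5⟩, hchain⟩ := hρ
  exact x4Chain_sound f ρ hg hlam hc3 hc4 hc5 hmodel ρ.ts ρ.r0 h0 hchain

/-- Demo row (X4) (hcp h-centred window, memo §0 numbers: from `r0 = 1.4·10⁻³` (end of (X2)) to `r1 = 0.03`, `λ = 5.37`, `c₃ = max|∂³|/6 ≤ 7/4`,
`c₄ = max|∂⁴|/24 ≤ 2`, an illustrative `c₅ = 10`, `|g| ≤ 3·10⁻⁷`, `e₀ = 0`, floor `5.13·10⁻⁸`; seven geometric cells of ratio `1.6`). -/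
example : x4Check ⟨7 / 5000, 3 / 100, 0, 3 / 10000000, 537 / 100, 7 / 4, 2, 10, 513 / 10000000000,
    [9 / 4000, 9 / 2500, 23 / 4000, 23 / 2500, 3 / 200, 3 / 125, 1 / 25]⟩ = true := by
  norm_num [x4Check, x4Chain, x4Lower]

/-! ## §6c Row (SC): the scale-bad cell (SB1) -/

/-- Row (SC) kernel for ONE cell of the scale-bad table: enclosures `Alo ≤ A`, `A ≤ Ahi`, `B ≤ Bhi`, `Blo ≤ B` of the quadratic's coefficients on the cell,
the constant `C`, the branch point `y` (`λ_S⁻⁶`-type lower bound on the increasing branch `inc = true`, `λ_L⁻⁶`-type upper bound on the decreasing one). -/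
def scCellCheck (Alo Ahi Blo Bhi C y : ℚ) (inc : Bool) : Bool :=
  (0 ≤ Alo) && (0 ≤ y) && (0 ≤ Alo * y ^ 2 - Bhi * y - C) && (if inc then Bhi ≤ 2 * Alo * y else 2 * Ahi * y ≤ Blo)

/-- ★ **Row (SC) soundness**: a passing cell row and the actual coefficients inside the cell's enclosures give `0 ≤ A x² − B x − C` for every `x` on the
cell's branch side of `y` (`x = a₀⁻⁶`; combine with `scaleBad_target_of_quadratic` and `inv_pow_six_ge_of_le` / `inv_pow_six_le_of_ge`). [this file] -/
theorem scCellCheck_sound {Alo Ahi Blo Bhi C y : ℚ} {inc : Bool} (h : scCellCheck Alo Ahi Blo Bhi C y inc = true) {A B x : ℝ}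
    (hAlo : (Alo : ℝ) ≤ A) (hAhi : A ≤ (Ahi : ℝ)) (hBlo : (Blo : ℝ) ≤ B) (hBhi : B ≤ (Bhi : ℝ))
    (hx : if inc then (y : ℝ) ≤ x else x ≤ (y : ℝ)) : 0 ≤ A * x ^ 2 - B * x - (C : ℝ) := by
  simp only [scCellCheck, Bool.and_eq_true, decide_eq_true_eq] at h
  obtain ⟨⟨⟨hA0, hy0⟩, hval⟩, hbr⟩ := h
  have hA0' : (0 : ℝ) ≤ Alo := by exact_mod_cast hA0
  have hy0' : (0 : ℝ) ≤ y := by exact_mod_cast hy0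
  have hval' : (0 : ℝ) ≤ (Alo : ℝ) * (y : ℝ) ^ 2 - Bhi * y - C := by exact_mod_cast hval
  have hA : 0 ≤ A := hA0'.trans hAlo
  have h0 : 0 ≤ A * (y : ℝ) ^ 2 - B * y - C := by nlinarith [mul_le_mul_of_nonneg_right hAlo (sq_nonneg (y : ℝ)), mul_le_mul_of_nonneg_right hBhi hy0']
  cases inc with
  | true =>
    simp only [if_true, decide_eq_true_eq] at hbr hx
    have hbr' : (Bhi : ℝ) ≤ 2 * Alo * y := by exact_mod_cast hbr
    exact quad_nonneg_of_le hA (by nlinarith) h0 hx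
  | false =>
    simp only [Bool.false_eq_true, if_false, decide_eq_true_eq] at hbr hx
    have hbr' : 2 * (Ahi : ℝ) * y ≤ Blo := by exact_mod_cast hbr
    exact quad_nonneg_of_ge hA (by nlinarith) h0 hx

/-- Demo row (SC) (hcp numbers of the g64 memo: bad scales `λ ∈ (0.96454, 0.97783)` i.e. roots `x₋ = 1.1440`, `x₊ = 1.24191` of `A x² − B x − C`
with `B = T₆/12 = 1.2046`, `A = 0.5049`, `C = −0.71727`; Short branch point `y = λ_S⁻⁶ = 1.30522 ≥ x₊`), a cell of half-width `10⁻⁴` in `A`, `B`: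
evaluated by `norm_num`. -/
example : scCellCheck (5048 / 10000) (5050 / 10000) (12045 / 10000) (12047 / 10000) (-71727 / 100000) (130522 / 100000) true = true := by
  norm_num [scCellCheck]

/-! ## §6d Gram certificate: the `σ_max` bound for the (N♯) growth term -/

/-- `‖Σₐ tₐ mₐ‖² = Σₐ Σ_b tₐ t_b ⟪mₐ, m_b⟫`. [this file] -/
theorem norm_sq_sum_smul {d : ℕ} (t : Fin d → ℝ) (m : Fin d → E3) :
    ‖∑ a, t a • m a‖ ^ 2 = ∑ a, ∑ b, t a * t b * inner ℝ (m a) (m b) := by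
  rw [← real_inner_self_eq_norm_sq, sum_inner]
  refine Finset.sum_congr rfl fun a _ => ?_
  rw [inner_sum]
  refine Finset.sum_congr rfl fun b _ => ?_
  rw [real_inner_smul_left, real_inner_smul_right]; ring

/-- Gram certificate data in dimension `d` (all ℚ): a rational approximation `Gt` of the Gram matrix `(⟪mₐ, m_b⟫)`, its entrywise tolerance `ε`, the
diagonal target `L2g a` (`= L² gₐ` for the weighted norm `Σ gₐ tₐ²`), and an `L·D·Lᵀ` certificate (`Lmat`, `D`) of `diag(L2g − d ε) − Gt`. -/
structure GramCert (d : ℕ) where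
  /-- rational Gram approximation -/
  Gt : Fin d → Fin d → ℚ
  /-- entrywise tolerance -/
  ε : ℚ
  /-- diagonal target -/
  L2g : Fin d → ℚ
  /-- LDLᵀ factor -/
  Lmat : Fin d → Fin d → ℚ
  /-- LDLᵀ diagonal -/
  D : Fin d → ℚ

/-- Gram kernel: `0 ≤ ε`, `0 ≤ D`, and the exact identity `diag(L2g − d ε) − Gt = Lmat · diag(D) · Lmatᵀ` entrywise. -/
def gramCheck {d : ℕ} (c : GramCert d) : Bool :=
  (0 ≤ c.ε) && decide (∀ k, 0 ≤ c.D k) &&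
    decide (∀ a b, (if a = b then c.L2g a - (d : ℚ) * c.ε else 0) - c.Gt a b = ∑ k, c.Lmat a k * c.D k * c.Lmat b k)

/-- ★ **Gram certificate soundness**: a passing certificate and ANY real matrix `G` entrywise within `ε` of `Gt` give
`Σₐ Σ_b tₐ t_b G_{ab} ≤ Σₐ L2gₐ tₐ²` for every real `t` (perturbation by Cauchy–Schwarz `(Σ|tₐ|)² ≤ d Σ tₐ²`, then the `LDLᵀ` sum of squares). [this file] -/
theorem gramCheck_sound {d : ℕ} {c : GramCert d} (hc : gramCheck c = true) {G : Fin d → Fin d → ℝ}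
    (hG : ∀ a b, |G a b - (c.Gt a b : ℝ)| ≤ (c.ε : ℝ)) (t : Fin d → ℝ) :
    ∑ a, ∑ b, t a * t b * G a b ≤ ∑ a, (c.L2g a : ℝ) * t a ^ 2 := by
  simp only [gramCheck, Bool.and_eq_true, decide_eq_true_eq] at hc
  obtain ⟨⟨hε, hD⟩, hM⟩ := hc
  have hε' : (0 : ℝ) ≤ c.ε := by exact_mod_cast hε
  -- the certified matrix, over ℝ
  have hM' : ∀ a b, (if a = b then (c.L2g a : ℝ) - (d : ℝ) * c.ε else 0) - (c.Gt a b : ℝ) =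
      ∑ k, (c.Lmat a k : ℝ) * c.D k * c.Lmat b k := by
    intro a b
    have h : (((if a = b then c.L2g a - (d : ℚ) * c.ε else 0) - c.Gt a b : ℚ) : ℝ) =
        ((∑ k, c.Lmat a k * c.D k * c.Lmat b k : ℚ) : ℝ) := by rw [hM a b]
    push_cast at h
    split_ifs at h ⊢ with hab
    · push_cast at h; exact h
    · push_cast at h; exact h
  -- Step 1: perturbation `Q(G) ≤ Q(Gt) + ε (Σ|t|)²`
  have h1 : ∑ a, ∑ b, t a * t b * G a b ≤ ∑ a, ∑ b, t a * t b * (c.Gt a b : ℝ) + (c.ε : ℝ) * (∑ a, |t a|) ^ 2 := by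
    have key : ∀ a b, t a * t b * G a b ≤ t a * t b * (c.Gt a b : ℝ) + c.ε * (|t a| * |t b|) := by
      intro a b
      have h := hG a b
      have : t a * t b * (G a b - c.Gt a b) ≤ c.ε * (|t a| * |t b|) :=
        calc t a * t b * (G a b - c.Gt a b) ≤ |t a * t b * (G a b - c.Gt a b)| := le_abs_self _
          _ = |t a| * |t b| * |G a b - c.Gt a b| := by rw [abs_mul, abs_mul]
          _ ≤ |t a| * |t b| * c.ε := mul_le_mul_of_nonneg_left h (by positivity)
          _ = c.ε * (|t a| * |t b|) := by ring
      linarith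
    have hsq : (c.ε : ℝ) * (∑ a, |t a|) ^ 2 = ∑ a, ∑ b, (c.ε : ℝ) * (|t a| * |t b|) := by
      rw [sq, Finset.sum_mul_sum, Finset.mul_sum]
      exact Finset.sum_congr rfl fun a _ => by rw [Finset.mul_sum]
    rw [hsq, ← Finset.sum_add_distrib]
    refine Finset.sum_le_sum fun a _ => ?_
    rw [← Finset.sum_add_distrib]
    exact Finset.sum_le_sum fun b _ => key a b
  -- Step 2: Cauchy–Schwarz `(Σ|tₐ|)² ≤ d Σ tₐ²`
  have h2 : (∑ a, |t a|) ^ 2 ≤ (d : ℝ) * ∑ a, t a ^ 2 := by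
    have h := Finset.sum_mul_sq_le_sq_mul_sq Finset.univ (fun a => |t a|) (fun _ => (1 : ℝ))
    simp only [mul_one, one_pow, Finset.sum_const, Finset.card_univ, Fintype.card_fin, sq_abs, nsmul_eq_mul] at h
    linarith
  -- Step 3: the certificate `Σ L2g t² − d ε Σ t² − Q(Gt) = Σ_k D_k (Σ_a L_{ak} t_a)² ≥ 0`
  have h3 : ∑ a, ∑ b, t a * t b * ((if a = b then (c.L2g a : ℝ) - (d : ℝ) * c.ε else 0) - (c.Gt a b : ℝ)) =
      ∑ k, (c.D k : ℝ) * (∑ a, (c.Lmat a k : ℝ) * t a) ^ 2 := by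
    calc ∑ a, ∑ b, t a * t b * ((if a = b then (c.L2g a : ℝ) - (d : ℝ) * c.ε else 0) - (c.Gt a b : ℝ))
        = ∑ a, ∑ b, ∑ k, (c.D k : ℝ) * (((c.Lmat a k : ℝ) * t a) * ((c.Lmat b k : ℝ) * t b)) := by
          refine Finset.sum_congr rfl fun a _ => Finset.sum_congr rfl fun b _ => ?_
          rw [hM' a b, Finset.mul_sum]
          exact Finset.sum_congr rfl fun k _ => by ring
      _ = ∑ a, ∑ k, ∑ b, (c.D k : ℝ) * (((c.Lmat a k : ℝ) * t a) * ((c.Lmat b k : ℝ) * t b)) :=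
          Finset.sum_congr rfl fun a _ => Finset.sum_comm
      _ = ∑ k, ∑ a, ∑ b, (c.D k : ℝ) * (((c.Lmat a k : ℝ) * t a) * ((c.Lmat b k : ℝ) * t b)) := Finset.sum_comm
      _ = ∑ k, (c.D k : ℝ) * (∑ a, (c.Lmat a k : ℝ) * t a) ^ 2 := by
          refine Finset.sum_congr rfl fun k _ => ?_
          rw [sq, Finset.sum_mul_sum, Finset.mul_sum]
          exact Finset.sum_congr rfl fun a _ => by rw [Finset.mul_sum]
  have h3d : ∑ a, ∑ b, t a * t b * ((if a = b then (c.L2g a : ℝ) - (d : ℝ) * c.ε else 0) - (c.Gt a b : ℝ)) =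
      ∑ a, ((c.L2g a : ℝ) - (d : ℝ) * c.ε) * t a ^ 2 - ∑ a, ∑ b, t a * t b * (c.Gt a b : ℝ) := by
    rw [← Finset.sum_sub_distrib]
    refine Finset.sum_congr rfl fun a _ => ?_
    have e : ∀ b, t a * t b * ((if a = b then (c.L2g a : ℝ) - (d : ℝ) * c.ε else 0) - (c.Gt a b : ℝ)) =
        (if a = b then ((c.L2g a : ℝ) - (d : ℝ) * c.ε) * (t a * t b) else 0) - t a * t b * (c.Gt a b : ℝ) := fun b => by
      split_ifs <;> ring
    rw [Finset.sum_congr rfl fun b _ => e b, Finset.sum_sub_distrib, Finset.sum_ite_eq, if_pos (Finset.mem_univ a)]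
    ring
  have h4 : 0 ≤ ∑ k, (c.D k : ℝ) * (∑ a, (c.Lmat a k : ℝ) * t a) ^ 2 :=
    Finset.sum_nonneg fun k _ => mul_nonneg (by exact_mod_cast hD k) (sq_nonneg _)
  have h5 : ∑ a, ((c.L2g a : ℝ) - (d : ℝ) * c.ε) * t a ^ 2 = ∑ a, (c.L2g a : ℝ) * t a ^ 2 - (d : ℝ) * c.ε * ∑ a, t a ^ 2 := by
    rw [Finset.mul_sum, ← Finset.sum_sub_distrib]
    exact Finset.sum_congr rfl fun a _ => by ring
  have h6 := mul_le_mul_of_nonneg_left h2 hε'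
  linarith [h1, h3, h3d, h4, h5, h6]

/-- ★ **The `σ_max` form of the (N♯) growth bound**: if `E x = Σₐ tₐ Fₐ x`, the Gram certificate of the vectors `mₐ := Fₐ w − ⟪v, Fₐ s⟫ w` passes with
diagonal target `L² gₐ` (`0 ≤ L`), and `t` lies in the weighted ball `Σ gₐ tₐ² ≤ r²` (`0 ≤ r`), then `‖E w − ⟪v, E s⟫ w‖ ≤ L r` — the `ℓ` a row (N♯)
consumes. [this file] -/
theorem norm_sub_smul_le_of_gram {d : ℕ} (t : Fin d → ℝ) (F : Fin d → E3 →L[ℝ] E3) {E : E3 →L[ℝ] E3} (hE : ∀ x, E x = ∑ a, t a • F a x)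
    (v s w : E3) {c : GramCert d} (hc : gramCheck c = true)
    (hG : ∀ a b, |inner ℝ (F a w - (inner ℝ v (F a s)) • w) (F b w - (inner ℝ v (F b s)) • w) - (c.Gt a b : ℝ)| ≤ (c.ε : ℝ))
    {L r : ℝ} (hL : 0 ≤ L) (hr : 0 ≤ r) (g : Fin d → ℝ) (hL2g : ∀ a, (c.L2g a : ℝ) = L ^ 2 * g a) (ht : ∑ a, g a * t a ^ 2 ≤ r ^ 2) :
    ‖E w - (inner ℝ v (E s)) • w‖ ≤ L * r := by
  have e : E w - (inner ℝ v (E s)) • w = ∑ a, t a • (F a w - (inner ℝ v (F a s)) • w) := by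
    rw [hE w, hE s, inner_sum, Finset.sum_smul, ← Finset.sum_sub_distrib]
    refine Finset.sum_congr rfl fun a _ => ?_
    rw [real_inner_smul_right, smul_sub, smul_smul]
  have hsq : ‖E w - (inner ℝ v (E s)) • w‖ ^ 2 ≤ (L * r) ^ 2 := by
    rw [e, norm_sq_sum_smul]
    refine (gramCheck_sound hc hG t).trans ?_
    have : ∑ a, (c.L2g a : ℝ) * t a ^ 2 = L ^ 2 * ∑ a, g a * t a ^ 2 := by
      rw [Finset.mul_sum]; exact Finset.sum_congr rfl fun a _ => by rw [hL2g a]; ring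
    rw [this, mul_pow]
    exact mul_le_mul_of_nonneg_left ht (sq_nonneg L)
  exact (pow_le_pow_iff_left₀ (norm_nonneg _) (mul_nonneg hL hr) two_ne_zero).1 hsq

/-- Demo Gram certificate (`d = 2`: `Gt = [[2,1],[1,2]]`, `ε = 0`, target `diag(3,3)`; `diag(3,3) − Gt = L D Lᵀ` with `L = [[1,0],[−1,1]]`, `D = (1,0)`),
evaluated by `decide`-free `norm_num`. -/
example : gramCheck (⟨![![2, 1], ![1, 2]], 0, ![3, 3], ![![1, 0], ![-1, 1]], ![1, 0]⟩ : GramCert 2) = true := by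
  norm_num [gramCheck, Fin.forall_fin_two, Fin.sum_univ_two]

end Summit.AtomisticToContinuum.Crystallization.Theorems.OverbindingBudgetAffineFarSmoothSplit
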